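import Summits.NavierStokesRegularity.NavierStokesRegularity.Theorems.OddMorawetzLocal.Negative.OddMorawetzLocalSymmetryDefs
import Summits.NavierStokesRegularity.NavierStokesRegularity.Theorems.OddMorawetzDefs
import Literature.Analysis.FluidPDE.VectorCalculus
import Literature.Analysis.Calculus.IteratedFDerivSymmetric

/-!
# `stub_jetCalculus`: jets of smooth fields in coordinates
  (crux `OddMorawetz.MorawetzKillsTypeI`, stmt-NavierStokesRegularity-1377, line `registered`)

Stub `stub_jetCalculus` of the lead's skeleton of the crux
`Summit.NavierStokesRegularity.NavierStokesRegularity.Theses.OddMorawetz.MorawetzKillsTypeI`: the six calculus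
facts about the 3-jet map `J w x = (w x, Dw x, D²w x, D³w x) ∈ Jet3` of a smooth field `w : ℝ³ → ℝ³` with which
null-Lagrangian certificates ("density = total divergence of an explicit flux of the jet") are verified pointwise
and the structure theorem on symmetric jets is transferred to derivatives.  With `eᵢ` the standard basis:

* (a) a smooth divergence-free field has trace-free jets: `∑ᵢ (Dw eᵢ)ᵢ = 0`, `∑ᵢ (D²w (eᵢ, eⱼ))ᵢ = 0`,
  `∑ᵢ (D³w (eᵢ, eⱼ, eₖ))ᵢ = 0` — `div w = ∑ᵢ (Dw eᵢ)ᵢ` (trace in the orthonormal basis `EuclideanSpace.basisFun`),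
  then differentiate the identity along `eⱼ`, `eₖ` (`∂_h Dⁿw = Dⁿ⁺¹w (h, ·)`, Mathlib `fderiv_iteratedFDeriv`) and
  reorder the slots by the symmetry of higher derivatives (the tree's Schwarz–Clairaut theorem
  `Literature.Analysis.Calculus.iteratedFDeriv_comp_perm_of_contDiff`);
* (b) `div_x [F (J w ·)] (x) = ∑ᵢ (DF(J w x) [∂ᵢ (J w)(x)])ᵢ` (chain rule + trace in coordinates);
* (c) the first three components of `∂ᵢ (J w)(x)` are `(Dw eᵢ, D²w(eᵢ, ·), D³w(eᵢ, ·, ·))` (product rule and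
  `fderiv_iteratedFDeriv`, definitionally);
* (d) a differentiable flux which ignores the top component `D³w` has a derivative which ignores it (the partial map
  along the last factor is constant, so its derivative — a directional derivative of `F` — vanishes);
* (e) two differentiable densities which agree on the linear subspace of symmetric jets have equal derivatives there
  along symmetric directions (restrict both to the line `z + s w`, which stays in the subspace);
* (f) jets of smooth fields are symmetric (Schwarz–Clairaut at orders 2 and 3).

Helpers live in the namespace `…Theorems.JetCalculus`; Mathlib + the tree's `VectorCalculus` (divergence) and
`IteratedFDerivSymmetric`; no definitions, no named facts, everything proved.
-/

noncomputable section

-- the problem namespace `Summit.NavierStokesRegularity.NavierStokesRegularity` repeats the summit name by design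
set_option linter.dupNamespace false

namespace Summit.NavierStokesRegularity.NavierStokesRegularity.Theorems

open Literature.Analysis.FluidPDE Literature.Analysis.Calculus
open Summit.NavierStokesRegularity.NavierStokesRegularity.Theorems.OddMorawetz

namespace JetCalculus

/-! ### Divergence in coordinates and differentiated trace identities -/

/-- `div v (x) = ∑ᵢ (Dv(x) eᵢ)ᵢ` on `ℝ³` (trace in the standard orthonormal basis). -/
theorem divergence_eq_sum (v : E3 → E3) (x : E3) :
    VectorCalculus.divergence v x = ∑ i : Fin 3, fderiv ℝ v x (EuclideanSpace.single i (1 : ℝ)) i := by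
  rw [divergence_eq_sum_inner_fderiv (EuclideanSpace.basisFun (Fin 3) ℝ)]
  simp only [EuclideanSpace.basisFun_inner]
  simp only [EuclideanSpace.basisFun_apply]

/-- Differentiating an identity `L (c y) = 0` (`L` a continuous linear functional) along a direction `v`:
`L (Dc(x) v) = 0`. -/
theorem apply_fderiv_eq_zero {M : Type*} [NormedAddCommGroup M] [NormedSpace ℝ M] {c : E3 → M} {x : E3}
    (hc : DifferentiableAt ℝ c x) (L : M →L[ℝ] ℝ) (hL : ∀ y, L (c y) = 0) (v : E3) :
    L (fderiv ℝ c x v) = 0 := by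
  have h1 : fderiv ℝ (fun y => L (c y)) x = L.comp (fderiv ℝ c x) :=
    (L.hasFDerivAt.comp x hc.hasFDerivAt).fderiv
  have h2 : fderiv ℝ (fun y => L (c y)) x = 0 := by
    rw [show (fun y => L (c y)) = fun _ => (0 : ℝ) from funext hL, fderiv_const_apply]
  have h3 := congrArg (fun T : E3 →L[ℝ] ℝ => T v) (h1.symm.trans h2)
  simpa using h3

/-- Differentiating a trace identity `∑ᵢ (c(y) mᵢ)ᵢ = 0` for a field `c` of `n`-multilinear maps along `v`:
`∑ᵢ ((Dc(x) v) mᵢ)ᵢ = 0`. -/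
theorem sum_fderiv_apply_eq_zero {n : ℕ} {c : E3 → (E3 [×n]→L[ℝ] E3)} {x : E3}
    (hc : DifferentiableAt ℝ c x) (m : Fin 3 → Fin n → E3) (h : ∀ y, ∑ i : Fin 3, c y (m i) i = 0) (v : E3) :
    ∑ i : Fin 3, fderiv ℝ c x v (m i) i = 0 := by
  have key := apply_fderiv_eq_zero hc
    (∑ i : Fin 3, (EuclideanSpace.proj i).comp (ContinuousMultilinearMap.apply ℝ (fun _ : Fin n => E3) E3 (m i)))
    (fun y => by simpa using h y) v
  simpa using key

variable {w : E3 → E3}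

/-- Every derivative of a smooth field is differentiable. -/
theorem differentiable_iteratedFDeriv_of_smooth (hw : ContDiff ℝ (⊤ : ℕ∞) w) (n : ℕ) :
    Differentiable ℝ (iteratedFDeriv ℝ n w) :=
  hw.differentiable_iteratedFDeriv (by exact_mod_cast ENat.coe_lt_top n)

/-- A smooth field is differentiable. -/
theorem differentiable_of_smooth (hw : ContDiff ℝ (⊤ : ℕ∞) w) : Differentiable ℝ w :=
  (hw.of_le (by exact_mod_cast le_top) : ContDiff ℝ 1 w).differentiable one_ne_zero

/-- Order one: `∑ᵢ (D¹w(y) (eᵢ))ᵢ = div w (y) = 0` for a divergence-free field. -/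
theorem trace_one (hdiv : VectorCalculus.IsDivFree w) (y : E3) :
    ∑ i : Fin 3, iteratedFDeriv ℝ 1 w y ![EuclideanSpace.single i (1 : ℝ)] i = 0 := by
  have h := hdiv y
  rw [divergence_eq_sum] at h
  simpa only [iteratedFDeriv_one_apply, Matrix.cons_val_zero] using h

/-- Order two (unsymmetrised): `∑ᵢ (D²w(y) (eⱼ, eᵢ))ᵢ = ∂ⱼ (div w) (y) = 0` for a smooth divergence-free field. -/
theorem trace_two (hw : ContDiff ℝ (⊤ : ℕ∞) w) (hdiv : VectorCalculus.IsDivFree w) (y : E3) (j : Fin 3) :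
    ∑ i : Fin 3, iteratedFDeriv ℝ 2 w y
      ![EuclideanSpace.single j (1 : ℝ), EuclideanSpace.single i (1 : ℝ)] i = 0 :=
  -- `D²w(y)(eⱼ, eᵢ) = (∂_{eⱼ} D¹w)(y)(eᵢ)` definitionally (`iteratedFDeriv_succ_apply_left`)
  sum_fderiv_apply_eq_zero (differentiable_iteratedFDeriv_of_smooth hw 1 y)
    (fun i => ![EuclideanSpace.single i (1 : ℝ)]) (trace_one hdiv) (EuclideanSpace.single j (1 : ℝ))

/-- Order three (unsymmetrised): `∑ᵢ (D³w(y) (eₖ, eⱼ, eᵢ))ᵢ = ∂ₖ∂ⱼ (div w) (y) = 0` for a smooth divergence-free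
field. -/
theorem trace_three (hw : ContDiff ℝ (⊤ : ℕ∞) w) (hdiv : VectorCalculus.IsDivFree w) (y : E3) (j k : Fin 3) :
    ∑ i : Fin 3, iteratedFDeriv ℝ 3 w y
      ![EuclideanSpace.single k (1 : ℝ), EuclideanSpace.single j (1 : ℝ), EuclideanSpace.single i (1 : ℝ)] i = 0 :=
  -- `D³w(y)(eₖ, eⱼ, eᵢ) = (∂_{eₖ} D²w)(y)(eⱼ, eᵢ)` definitionally
  sum_fderiv_apply_eq_zero (differentiable_iteratedFDeriv_of_smooth hw 2 y)
    (fun i => ![EuclideanSpace.single j (1 : ℝ), EuclideanSpace.single i (1 : ℝ)]) (fun y' => trace_two hw hdiv y' j)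
    (EuclideanSpace.single k (1 : ℝ))

/-- **(a)** Trace-free jets of a smooth divergence-free field, in the registered slot order (the slots are
reordered by the symmetry of `D²w`, `D³w`). -/
theorem trace_free (hw : ContDiff ℝ (⊤ : ℕ∞) w) (hdiv : VectorCalculus.IsDivFree w) (x : E3) :
    (∑ i : Fin 3, iteratedFDeriv ℝ 1 w x (fun _ => EuclideanSpace.single i (1 : ℝ)) i = 0) ∧
    (∀ j : Fin 3, ∑ i : Fin 3, iteratedFDeriv ℝ 2 w x
      ![EuclideanSpace.single i (1 : ℝ), EuclideanSpace.single j (1 : ℝ)] i = 0) ∧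
    (∀ j k : Fin 3, ∑ i : Fin 3, iteratedFDeriv ℝ 3 w x
      ![EuclideanSpace.single i (1 : ℝ), EuclideanSpace.single j (1 : ℝ), EuclideanSpace.single k (1 : ℝ)] i = 0) := by
  refine ⟨?_, fun j => ?_, fun j k => ?_⟩
  · have h := hdiv x
    rw [divergence_eq_sum] at h
    simpa only [iteratedFDeriv_one_apply] using h
  · rw [← trace_two hw hdiv x j]
    refine Finset.sum_congr rfl fun i _ => ?_
    have hv : (![EuclideanSpace.single j (1 : ℝ), EuclideanSpace.single i (1 : ℝ)] : Fin 2 → E3) =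
        ![EuclideanSpace.single i (1 : ℝ), EuclideanSpace.single j (1 : ℝ)] ∘ Equiv.swap 0 1 := by
      funext s
      fin_cases s <;> rfl
    rw [hv, iteratedFDeriv_comp_perm_of_contDiff hw (WithTop.coe_le_coe.2 le_top)]
  · rw [← trace_three hw hdiv x j k]
    refine Finset.sum_congr rfl fun i _ => ?_
    have hv : (![EuclideanSpace.single k (1 : ℝ), EuclideanSpace.single j (1 : ℝ), EuclideanSpace.single i (1 : ℝ)] :
          Fin 3 → E3) =
        ![EuclideanSpace.single i (1 : ℝ), EuclideanSpace.single j (1 : ℝ), EuclideanSpace.single k (1 : ℝ)] ∘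
          Equiv.swap 0 2 := by
      funext s
      fin_cases s <;> rfl
    rw [hv, iteratedFDeriv_comp_perm_of_contDiff hw (WithTop.coe_le_coe.2 le_top)]

/-! ### The derivative of the jet map -/

/-- The 3-jet map of a smooth field is differentiable. -/
theorem differentiableAt_jet (hw : ContDiff ℝ (⊤ : ℕ∞) w) (x : E3) :
    DifferentiableAt ℝ (fun y =>
      ((w y, iteratedFDeriv ℝ 1 w y, iteratedFDeriv ℝ 2 w y, iteratedFDeriv ℝ 3 w y) : Jet3)) x := by
  have hd := differentiable_iteratedFDeriv_of_smooth hw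
  exact (differentiable_of_smooth hw x).prodMk ((hd 1 x).prodMk ((hd 2 x).prodMk (hd 3 x)))

/-- The derivative of the 3-jet map along `h`:
`∂_h (w, Dw, D²w, D³w)(x) = (Dw(x) h, D²w(x)(h, ·), D³w(x)(h, ·, ·), D⁴w(x)(h, ·, ·, ·))` (product rule; then
Mathlib's `fderiv_iteratedFDeriv`, which holds by `rfl`). -/
theorem fderiv_jet_apply (hw : ContDiff ℝ (⊤ : ℕ∞) w) (x h : E3) :
    fderiv ℝ (fun y => ((w y, iteratedFDeriv ℝ 1 w y, iteratedFDeriv ℝ 2 w y, iteratedFDeriv ℝ 3 w y) : Jet3)) x h =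
      (fderiv ℝ w x h, (iteratedFDeriv ℝ 2 w x).curryLeft h, (iteratedFDeriv ℝ 3 w x).curryLeft h,
        (iteratedFDeriv ℝ 4 w x).curryLeft h) := by
  have hd := differentiable_iteratedFDeriv_of_smooth hw
  have hder := ((differentiable_of_smooth hw x).hasFDerivAt.prodMk ((hd 1 x).hasFDerivAt.prodMk
    ((hd 2 x).hasFDerivAt.prodMk (hd 3 x).hasFDerivAt))).fderiv
  rw [hder]
  rfl

/-- **(c)** The first three components of `∂ᵢ (J w)(x)` are `(D¹w(x)(eᵢ), D²w(x)(eᵢ, ·), D³w(x)(eᵢ, ·, ·))`. -/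
theorem fderiv_jet_components (hw : ContDiff ℝ (⊤ : ℕ∞) w) (x h : E3) :
    (fderiv ℝ (fun y =>
        ((w y, iteratedFDeriv ℝ 1 w y, iteratedFDeriv ℝ 2 w y, iteratedFDeriv ℝ 3 w y) : Jet3)) x h).1 =
      iteratedFDeriv ℝ 1 w x (fun _ => h) ∧
    (fderiv ℝ (fun y =>
        ((w y, iteratedFDeriv ℝ 1 w y, iteratedFDeriv ℝ 2 w y, iteratedFDeriv ℝ 3 w y) : Jet3)) x h).2.1 =
      (iteratedFDeriv ℝ 2 w x).curryLeft h ∧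
    (fderiv ℝ (fun y =>
        ((w y, iteratedFDeriv ℝ 1 w y, iteratedFDeriv ℝ 2 w y, iteratedFDeriv ℝ 3 w y) : Jet3)) x h).2.2.1 =
      (iteratedFDeriv ℝ 3 w x).curryLeft h := by
  rw [fderiv_jet_apply hw]
  exact ⟨by rw [iteratedFDeriv_one_apply], rfl, rfl⟩

/-- **(b)** The divergence of a `C¹` flux of the 3-jet is the trace of the chain rule:
`div_x [F (J w ·)] (x) = ∑ᵢ (DF(J w x) [∂ᵢ (J w)(x)])ᵢ`. -/
theorem divergence_flux (F : Jet3 → E3) (hF : ContDiff ℝ 1 F) (hw : ContDiff ℝ (⊤ : ℕ∞) w) (x : E3) :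
    VectorCalculus.divergence (fun y =>
        F ((w y, iteratedFDeriv ℝ 1 w y, iteratedFDeriv ℝ 2 w y, iteratedFDeriv ℝ 3 w y) : Jet3)) x =
      ∑ i : Fin 3, fderiv ℝ F ((w x, iteratedFDeriv ℝ 1 w x, iteratedFDeriv ℝ 2 w x, iteratedFDeriv ℝ 3 w x) : Jet3)
        (fderiv ℝ (fun y =>
          ((w y, iteratedFDeriv ℝ 1 w y, iteratedFDeriv ℝ 2 w y, iteratedFDeriv ℝ 3 w y) : Jet3)) x
          (EuclideanSpace.single i (1 : ℝ))) i := by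
  have hcomp : HasFDerivAt (fun y =>
      F ((w y, iteratedFDeriv ℝ 1 w y, iteratedFDeriv ℝ 2 w y, iteratedFDeriv ℝ 3 w y) : Jet3))
      ((fderiv ℝ F ((w x, iteratedFDeriv ℝ 1 w x, iteratedFDeriv ℝ 2 w x, iteratedFDeriv ℝ 3 w x) : Jet3)).comp
        (fderiv ℝ (fun y =>
          ((w y, iteratedFDeriv ℝ 1 w y, iteratedFDeriv ℝ 2 w y, iteratedFDeriv ℝ 3 w y) : Jet3)) x)) x :=
    (hF.differentiable one_ne_zero _).hasFDerivAt.comp x (differentiableAt_jet hw x).hasFDerivAt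
  rw [divergence_eq_sum, hcomp.fderiv]
  rfl

/-! ### Derivatives along lines in the jet space -/

/-- Derivative along a line: `d/ds f (z + s w) |_{s = 0} = Df(z) w`. -/
theorem hasDerivAt_line {V G : Type*} [NormedAddCommGroup V] [NormedSpace ℝ V] [NormedAddCommGroup G]
    [NormedSpace ℝ G] {f : V → G} {z : V} (hf : DifferentiableAt ℝ f z) (w : V) :
    HasDerivAt (fun s : ℝ => f (z + s • w)) (fderiv ℝ f z w) 0 := by
  have hl : HasDerivAt (fun s : ℝ => z + s • w) w 0 := by
    simpa using ((hasDerivAt_id (0 : ℝ)).smul_const w).const_add z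
  have hf' : HasFDerivAt f (fderiv ℝ f z) (z + (0 : ℝ) • w) := by
    rw [zero_smul, add_zero]
    exact hf.hasFDerivAt
  exact hf'.comp_hasDerivAt (0 : ℝ) hl

/-- **(e), abstract form.** Two differentiable functions which agree on a set stable under `(z, w) ↦ z + s w`
have equal derivatives at its points along its directions. -/
theorem fderiv_eq_of_eqOn {V : Type*} [NormedAddCommGroup V] [NormedSpace ℝ V] {S : V → Prop}
    (hS : ∀ z w : V, S z → S w → ∀ s : ℝ, S (z + s • w)) {m₁ m₂ : V → ℝ} (h₁ : Differentiable ℝ m₁)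
    (h₂ : Differentiable ℝ m₂) (heq : ∀ z, S z → m₁ z = m₂ z) {z w : V} (hz : S z) (hw : S w) :
    fderiv ℝ m₁ z w = fderiv ℝ m₂ z w := by
  have e₁ := hasDerivAt_line (h₁ z) w
  have hfun : (fun s : ℝ => m₁ (z + s • w)) = fun s => m₂ (z + s • w) :=
    funext fun s => heq _ (hS z w hz hw s)
  rw [hfun] at e₁
  exact e₁.unique (hasDerivAt_line (h₂ z) w)

/-- The symmetric jets form a set stable under `(z, w) ↦ z + s w` (a linear subspace). -/
theorem symm_line (z w : Jet3)
    (hz : (∀ (h : Fin 2 → E3) (σ : Equiv.Perm (Fin 2)), z.2.2.1 (h ∘ σ) = z.2.2.1 h) ∧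
      (∀ (h : Fin 3 → E3) (σ : Equiv.Perm (Fin 3)), z.2.2.2 (h ∘ σ) = z.2.2.2 h))
    (hw : (∀ (h : Fin 2 → E3) (σ : Equiv.Perm (Fin 2)), w.2.2.1 (h ∘ σ) = w.2.2.1 h) ∧
      (∀ (h : Fin 3 → E3) (σ : Equiv.Perm (Fin 3)), w.2.2.2 (h ∘ σ) = w.2.2.2 h)) (s : ℝ) :
    (∀ (h : Fin 2 → E3) (σ : Equiv.Perm (Fin 2)), (z + s • w).2.2.1 (h ∘ σ) = (z + s • w).2.2.1 h) ∧
      (∀ (h : Fin 3 → E3) (σ : Equiv.Perm (Fin 3)), (z + s • w).2.2.2 (h ∘ σ) = (z + s • w).2.2.2 h) :=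
  ⟨fun h σ => by
    simp only [Prod.snd_add, Prod.fst_add, Prod.smul_snd, Prod.smul_fst, add_apply, smul_apply, hz.1 h σ, hw.1 h σ],
  fun h σ => by
    simp only [Prod.snd_add, Prod.smul_snd, add_apply, smul_apply, hz.2 h σ, hw.2 h σ]⟩

/-- **(d)** A differentiable flux which ignores the top jet component has a derivative which ignores it. -/
theorem fderiv_indep_top (F : Jet3 → E3) (hF : Differentiable ℝ F)
    (hc : ∀ (z : Jet3) (t : E3 [×3]→L[ℝ] E3), F (z.1, z.2.1, z.2.2.1, t) = F (z.1, z.2.1, z.2.2.1, 0))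
    (z w w' : Jet3) (h1 : w.1 = w'.1) (h2 : w.2.1 = w'.2.1) (h3 : w.2.2.1 = w'.2.2.1) :
    fderiv ℝ F z w = fderiv ℝ F z w' := by
  rcases z with ⟨z₀, z₁, z₂, z₃⟩
  -- the partial map along the last factor `t ↦ (z₀, z₁, z₂, t)` has derivative `d ↦ (0, 0, 0, d)` ...
  have hι : HasFDerivAt (fun t : E3 [×3]→L[ℝ] E3 => ((z₀, z₁, z₂, t) : Jet3))
      ((0 : (E3 [×3]→L[ℝ] E3) →L[ℝ] E3).prod ((0 : (E3 [×3]→L[ℝ] E3) →L[ℝ] (E3 [×1]→L[ℝ] E3)).prod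
        ((0 : (E3 [×3]→L[ℝ] E3) →L[ℝ] (E3 [×2]→L[ℝ] E3)).prod (ContinuousLinearMap.id ℝ (E3 [×3]→L[ℝ] E3)))))
      z₃ :=
    (hasFDerivAt_const _ _).prodMk ((hasFDerivAt_const _ _).prodMk
      ((hasFDerivAt_const _ _).prodMk (hasFDerivAt_id _)))
  -- ... and `F` is constant along it, so `DF(z) (0, 0, 0, d) = 0`
  have hcomp := (hF (z₀, z₁, z₂, z₃)).hasFDerivAt.comp z₃ hι
  have hconst : HasFDerivAt (F ∘ fun t : E3 [×3]→L[ℝ] E3 => ((z₀, z₁, z₂, t) : Jet3))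
      (0 : (E3 [×3]→L[ℝ] E3) →L[ℝ] E3) z₃ := by
    have : (F ∘ fun t : E3 [×3]→L[ℝ] E3 => ((z₀, z₁, z₂, t) : Jet3)) = fun _ => F (z₀, z₁, z₂, 0) :=
      funext fun t => hc (z₀, z₁, z₂, z₃) t
    rw [this]
    exact hasFDerivAt_const _ _
  have hzero : ∀ d : E3 [×3]→L[ℝ] E3,
      fderiv ℝ F (z₀, z₁, z₂, z₃) ((0 : E3), (0 : E3 [×1]→L[ℝ] E3), (0 : E3 [×2]→L[ℝ] E3), d) = 0 := by
    intro d
    have := congrArg (fun T : (E3 [×3]→L[ℝ] E3) →L[ℝ] E3 => T d) (hcomp.unique hconst)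
    simpa using this
  have hw : w = w' + ((0 : E3), (0 : E3 [×1]→L[ℝ] E3), (0 : E3 [×2]→L[ℝ] E3), w.2.2.2 - w'.2.2.2) :=
    Prod.ext (by simp [h1]) (Prod.ext (by simp [h2]) (Prod.ext (by simp [h3]) (by simp)))
  rw [hw, map_add, hzero, add_zero]

/-- **(f)** Jets of smooth fields are symmetric (Schwarz–Clairaut at orders 2 and 3). -/
theorem jet_symm (hw : ContDiff ℝ (⊤ : ℕ∞) w) (x : E3) :
    (∀ (h : Fin 2 → E3) (σ : Equiv.Perm (Fin 2)), iteratedFDeriv ℝ 2 w x (h ∘ σ) = iteratedFDeriv ℝ 2 w x h) ∧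
      (∀ (h : Fin 3 → E3) (σ : Equiv.Perm (Fin 3)), iteratedFDeriv ℝ 3 w x (h ∘ σ) = iteratedFDeriv ℝ 3 w x h) :=
  ⟨fun h σ => iteratedFDeriv_comp_perm_of_contDiff hw (WithTop.coe_le_coe.2 le_top) x h σ,
    fun h σ => iteratedFDeriv_comp_perm_of_contDiff hw (WithTop.coe_le_coe.2 le_top) x h σ⟩

end JetCalculus

open JetCalculus in
/-- **`stub_jetCalculus`** (stub of the skeleton of the crux `OddMorawetz.MorawetzKillsTypeI`,
stmt-NavierStokesRegularity-1377, line `registered`). **Jets of smooth fields in coordinates.** (a) divergence-free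
fields have trace-free jets at orders 1, 2, 3; (b) the divergence of a flux of the 3-jet is the trace of the chain
rule; (c) the derivative of the 3-jet map along `eᵢ` has first three components `(Dw eᵢ, D²w(eᵢ,·), D³w(eᵢ,·,·))`
(Mathlib `fderiv_iteratedFDeriv`); (d) a flux that ignores the top jet component has a derivative that ignores it;
(e) two differentiable densities that agree on the symmetric jets have the same derivative there along symmetric
directions; (f) jets of smooth fields are symmetric. -/
theorem stub_jetCalculus :
    let e : Fin 3 → E3 := fun i => EuclideanSpace.single i (1 : ℝ);
    let Symm : Jet3 → Prop := fun z =>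
      (∀ (h : Fin 2 → E3) (σ : Equiv.Perm (Fin 2)), z.2.2.1 (h ∘ σ) = z.2.2.1 h) ∧
      (∀ (h : Fin 3 → E3) (σ : Equiv.Perm (Fin 3)), z.2.2.2 (h ∘ σ) = z.2.2.2 h);
    let J := fun (v : E3 → E3) (x : E3) => ((v x, iteratedFDeriv ℝ 1 v x, iteratedFDeriv ℝ 2 v x, iteratedFDeriv ℝ 3 v x) : Jet3);
    (∀ w : E3 → E3, ContDiff ℝ (⊤ : ℕ∞) w → Literature.Analysis.FluidPDE.VectorCalculus.IsDivFree w → ∀ x : E3,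
      (∑ i : Fin 3, iteratedFDeriv ℝ 1 w x (fun _ => e i) i = 0) ∧
      (∀ j : Fin 3, ∑ i : Fin 3, iteratedFDeriv ℝ 2 w x ![e i, e j] i = 0) ∧
      (∀ j k : Fin 3, ∑ i : Fin 3, iteratedFDeriv ℝ 3 w x ![e i, e j, e k] i = 0)) ∧
    (∀ (F : Jet3 → E3) (w : E3 → E3), ContDiff ℝ 1 F → ContDiff ℝ (⊤ : ℕ∞) w → ∀ x : E3,
      Literature.Analysis.FluidPDE.VectorCalculus.divergence (fun y => F (J w y)) x =
        ∑ i : Fin 3, fderiv ℝ F (J w x) (fderiv ℝ (fun y => J w y) x (e i)) i) ∧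
    (∀ (w : E3 → E3), ContDiff ℝ (⊤ : ℕ∞) w → ∀ (x : E3) (i : Fin 3),
      (fderiv ℝ (fun y => J w y) x (e i)).1 = (J w x).2.1 (fun _ => e i) ∧
      (fderiv ℝ (fun y => J w y) x (e i)).2.1 = (J w x).2.2.1.curryLeft (e i) ∧
      (fderiv ℝ (fun y => J w y) x (e i)).2.2.1 = (J w x).2.2.2.curryLeft (e i)) ∧
    (∀ (F : Jet3 → E3), Differentiable ℝ F →
      (∀ (z : Jet3) (t : E3 [×3]→L[ℝ] E3), F (z.1, z.2.1, z.2.2.1, t) = F (z.1, z.2.1, z.2.2.1, 0)) →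
      ∀ (z w w' : Jet3), w.1 = w'.1 → w.2.1 = w'.2.1 → w.2.2.1 = w'.2.2.1 → fderiv ℝ F z w = fderiv ℝ F z w') ∧
    (∀ (m₁ m₂ : Jet3 → ℝ), Differentiable ℝ m₁ → Differentiable ℝ m₂ → (∀ z, Symm z → m₁ z = m₂ z) →
      ∀ (z w : Jet3), Symm z → Symm w → fderiv ℝ m₁ z w = fderiv ℝ m₂ z w) ∧
    (∀ (w : E3 → E3), ContDiff ℝ (⊤ : ℕ∞) w → ∀ x : E3, Symm (J w x)) := by
  intro e Symm J
  exact ⟨fun w hw hdiv x => trace_free hw hdiv x,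
    fun F w hF hw x => divergence_flux F hF hw x,
    fun w hw x i => fderiv_jet_components hw x (e i),
    fun F hF hc z w w' h1 h2 h3 => fderiv_indep_top F hF hc z w w' h1 h2 h3,
    fun m₁ m₂ h₁ h₂ heq z w hz hw => fderiv_eq_of_eqOn (S := Symm) (fun z' w' hz' hw' s => symm_line z' w' hz' hw' s)
      h₁ h₂ heq hz hw,
    fun w hw x => jet_symm hw x⟩

end Summit.NavierStokesRegularity.NavierStokesRegularity.Theorems

end
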